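import Summits.AtomisticToContinuum.FouriersLaw.Theorems.IncoherentChannel.Negative.KernelMoments
import Literature.MathematicalPhysics.KineticTheory.ChainControl

/-!
# IncoherentChannel, harmonic corner (3/4): polynomial-growth integrability and Stein / Wick identities of the Gibbs measure in the momenta

Negative-side support for crux `PhononMeanFreePath.IncoherentChannel` (item stmt-AtomisticToContinuum-11811),
`Disproof.lean` §5 continued (sorry-free, no definitions). For EVERY chain `pinnedChain ω₂ lam β γ`
(`ω₂ > 0`, `lam, β ≥ 0`) at `T > 0`: continuous observables with `|F| ≤ A(1+‖x‖²)²` are integrable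
against `e^{-H/T}` and the Gibbs measure (`integrable_mul_gibbsDensity_of_growth`,
`integrable_gibbsMeasure_of_growth`); **Stein's identity in a momentum direction**
`∫ p_i F dμ_T = T ∫ ∂_{p_i}F dμ_T` (`stein_momentum`; momenta are exactly Gaussian and independent of
positions, anharmonic chains included); consequences: equipartition `∫ p_i² dμ_T = T`
(`gibbs_sq_momentum`), `∫ p_i L dμ_T = T·L(e_{p_i})` (`gibbs_momentum_mul_clm`) and the Wick pair
identity `∫ p_i² L² dμ_T = T∫L² dμ_T + 2(∫ p_i L dμ_T)²` for a continuous linear functional `L`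
(`gibbs_sq_momentum_mul_clm_sq`).
-/

noncomputable section

open MeasureTheory Filter Topology Set
open scoped NNReal
open Literature.MathematicalPhysics.KineticTheory.HeatConduction
open Literature.Probability.Process
open Literature.Barriers.AtomisticToContinuum.HeatConduction (hamiltonian_smul)
open Summit.AtomisticToContinuum.FouriersLaw.Theses.PhononMeanFreePath
open Summit.AtomisticToContinuum.FouriersLaw.Theorems.IncoherentChannel.Negative.HarmonicFlow Summit.AtomisticToContinuum.FouriersLaw.Theorems.IncoherentChannel.Negative.KernelMoments

namespace Summit.AtomisticToContinuum.FouriersLaw.Theorems.IncoherentChannel.Negative.GibbsStein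

section GibbsMoments

variable {ω₂ lam β γ : ℝ} (hω : 0 < ω₂) (hl : 0 ≤ lam) (hβ : 0 ≤ β) {n : ℕ} {T : ℝ} (hT : 0 < T)
include hω hl hβ hT

/-- **Polynomially growing observables are Gibbs-integrable**: a continuous `F` with
`|F| ≤ A (1 + ‖x‖²)²` is integrable against `e^{-H/T}` (`T > 0`; coercivity `‖x‖² ≤ cH` and
`(1+H)² e^{-H/T} ≤ K e^{-H/(2T)}`). [folklore] -/
theorem integrable_mul_gibbsDensity_of_growth {F : PhaseSpace n → ℝ} (hF : Continuous F) {A : ℝ}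
    (hA : ∀ x, |F x| ≤ A * (1 + ‖x‖ ^ 2) ^ 2) :
    Integrable fun x => F x * (pinnedChain ω₂ lam β γ).gibbsDensity n T x := by
  set c : ℝ := 2 * max ω₂⁻¹ 1 with hc
  have hc1 : 1 ≤ c := by
    rw [hc]; have := le_max_right ω₂⁻¹ 1; linarith
  have hs : 0 < T⁻¹ / 2 := by positivity
  have hA0 : 0 ≤ A := by
    have h := hA 0
    have h1 : (0 : ℝ) ≤ |F 0| := abs_nonneg _
    have h2 : (1 + ‖(0 : PhaseSpace n)‖ ^ 2) ^ 2 = 1 := by simp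
    rw [h2, mul_one] at h
    linarith
  -- the majorant `A c² (2e^s/s²) e^{sH} e^{-H/T}`, integrable since `s = 1/(2T) < 1/T`
  have hmaj := (pinnedChain_integrable_exp_mul_gibbsDensity hω hl hβ γ n hT
    (show T⁻¹ / 2 < 1 / T by rw [one_div]; linarith [inv_pos.2 hT])).const_mul
    (A * c ^ 2 * (2 * Real.exp (T⁻¹ / 2) / (T⁻¹ / 2) ^ 2))
  refine hmaj.mono' ((hF.mul (pinnedChain_continuous_gibbsDensity ω₂ lam β γ n T)).aestronglyMeasurable)
    (Eventually.of_forall fun x => ?_)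
  have hH0 := pinnedChain_hamiltonian_nonneg hω.le hl hβ γ n x
  set H := (pinnedChain ω₂ lam β γ).hamiltonian n x with hH
  have hρ : 0 < (pinnedChain ω₂ lam β γ).gibbsDensity n T x := (pinnedChain ω₂ lam β γ).gibbsDensity_pos n T x
  rw [Real.norm_eq_abs, abs_mul, abs_of_pos hρ]
  have hx : ‖x‖ ^ 2 ≤ c * H := norm_sq_le_mul_hamiltonian hω hl hβ γ x
  have h1 : (1 + ‖x‖ ^ 2) ^ 2 ≤ c ^ 2 * (1 + H) ^ 2 := by
    have : 1 + ‖x‖ ^ 2 ≤ c * (1 + H) := by nlinarith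
    have h0 : 0 ≤ 1 + ‖x‖ ^ 2 := by positivity
    calc (1 + ‖x‖ ^ 2) ^ 2 ≤ (c * (1 + H)) ^ 2 := pow_le_pow_left₀ h0 this 2
      _ = c ^ 2 * (1 + H) ^ 2 := by ring
  have h2 := one_add_sq_le_exp hH0 hs
  calc |F x| * (pinnedChain ω₂ lam β γ).gibbsDensity n T x
      ≤ A * (1 + ‖x‖ ^ 2) ^ 2 * (pinnedChain ω₂ lam β γ).gibbsDensity n T x :=
        mul_le_mul_of_nonneg_right (hA x) hρ.le
    _ ≤ A * (c ^ 2 * (1 + H) ^ 2) * (pinnedChain ω₂ lam β γ).gibbsDensity n T x := by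
        gcongr
    _ ≤ A * (c ^ 2 * (2 * Real.exp (T⁻¹ / 2) / (T⁻¹ / 2) ^ 2 * Real.exp (T⁻¹ / 2 * H))) *
          (pinnedChain ω₂ lam β γ).gibbsDensity n T x := by
        gcongr
    _ = A * c ^ 2 * (2 * Real.exp (T⁻¹ / 2) / (T⁻¹ / 2) ^ 2) *
          (Real.exp (T⁻¹ / 2 * H) * (pinnedChain ω₂ lam β γ).gibbsDensity n T x) := by ring

/-- Hence such observables are integrable for the Gibbs MEASURE. [folklore] -/
theorem integrable_gibbsMeasure_of_growth {F : PhaseSpace n → ℝ} (hF : Continuous F) {A : ℝ}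
    (hA : ∀ x, |F x| ≤ A * (1 + ‖x‖ ^ 2) ^ 2) :
    Integrable F ((pinnedChain ω₂ lam β γ).gibbsMeasure n T) :=
  (pinnedChain ω₂ lam β γ).integrable_gibbsMeasure (integrable_mul_gibbsDensity_of_growth hω hl hβ hT hF hA)

/-- **Stein's identity in a momentum direction (the Gibbs measure is Gaussian in every `p_i`)**:
for `F` differentiable along `e_{p_i}` with derivative `F'`, and `F, F', p_iF` of polynomial growth,
`∫ p_i F dμ_T = T ∫ F' dμ_T` — for EVERY chain of the family (anharmonic included).
[folklore] -/
theorem stein_momentum (i : Fin n) {F F' : PhaseSpace n → ℝ} (hFc : Continuous F) (hF'c : Continuous F')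
    (hF : ∀ x, HasLineDerivAt ℝ F (F' x) x ((0, Pi.single i 1) : PhaseSpace n)) {A : ℝ}
    (hA : ∀ x, |F x| ≤ A * (1 + ‖x‖ ^ 2) ^ 2) (hA' : ∀ x, |F' x| ≤ A * (1 + ‖x‖ ^ 2) ^ 2)
    (hAp : ∀ x, |x.2 i * F x| ≤ A * (1 + ‖x‖ ^ 2) ^ 2) :
    ∫ x, x.2 i * F x ∂((pinnedChain ω₂ lam β γ).gibbsMeasure n T) =
      T * ∫ x, F' x ∂((pinnedChain ω₂ lam β γ).gibbsMeasure n T) := by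
  set P := pinnedChain ω₂ lam β γ with hP
  haveI : (volume : Measure (PhaseSpace n)).IsAddHaarMeasure :=
    @Measure.prod.instIsAddHaarMeasure (Fin n → ℝ) _ _ _ (Fin n → ℝ) _ _ _ volume volume _ _ _ _ _ _
  -- IBP: ∫ F · ∂_{p_i}ρ = -∫ F' ρ, with ∂_{p_i}ρ = -(p_i/T) ρ
  have hρ' : ∀ x, HasLineDerivAt ℝ (P.gibbsDensity n T) (-(x.2 i / T) * P.gibbsDensity n T x) x
      ((0, Pi.single i 1) : PhaseSpace n) := fun x =>
    P.hasLineDerivAt_gibbsDensity (P.hasLineDerivAt_hamiltonian_unitP n x i)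
  have hIF : Integrable (fun x => F x * P.gibbsDensity n T x) :=
    integrable_mul_gibbsDensity_of_growth hω hl hβ hT hFc hA
  have hIF' : Integrable (fun x => F' x * P.gibbsDensity n T x) :=
    integrable_mul_gibbsDensity_of_growth hω hl hβ hT hF'c hA'
  have hIFp : Integrable (fun x => x.2 i * F x * P.gibbsDensity n T x) :=
    integrable_mul_gibbsDensity_of_growth hω hl hβ hT ((by fun_prop : Continuous fun x : PhaseSpace n => x.2 i).mul hFc) hAp
  have e := integral_bilinear_hasLineDerivAt_right_eq_neg_left_of_integrable
    (μ := (volume : Measure (PhaseSpace n))) (B := ContinuousLinearMap.mul ℝ ℝ)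
    (f := F) (f' := F') (g := P.gibbsDensity n T) (g' := fun x => -(x.2 i / T) * P.gibbsDensity n T x)
    (v := ((0, Pi.single i 1) : PhaseSpace n)) ?_ ?_ ?_ (fun x _ => hF x) (fun x _ => hρ' x)
  · simp only [ContinuousLinearMap.mul_apply'] at e
    -- e : ∫ F x * (-(x.2 i / T) * ρ x) = -∫ F' x * ρ x
    have e2 : ∫ x, x.2 i * F x * P.gibbsDensity n T x = T * ∫ x, F' x * P.gibbsDensity n T x := by
      have e3 : ∫ x, F x * (-(x.2 i / T) * P.gibbsDensity n T x) =
          -(T⁻¹) * ∫ x, x.2 i * F x * P.gibbsDensity n T x := by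
        rw [← integral_const_mul]
        refine integral_congr_ae (Eventually.of_forall fun x => ?_)
        simp only [div_eq_mul_inv]
        ring
      rw [e3] at e
      have hT0 : T ≠ 0 := hT.ne'
      field_simp at e
      linarith
    rw [P.integral_gibbsMeasure, P.integral_gibbsMeasure (fun x => F' x), e2]
    ring
  · simp only [ContinuousLinearMap.mul_apply']
    exact hIF'
  · simp only [ContinuousLinearMap.mul_apply']
    have : (fun x => F x * (-(x.2 i / T) * P.gibbsDensity n T x)) =
        fun x => -(T⁻¹) * (x.2 i * F x * P.gibbsDensity n T x) := by
      funext x; simp only [div_eq_mul_inv]; ring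
    rw [this]
    exact hIFp.const_mul _
  · simp only [ContinuousLinearMap.mul_apply']
    exact hIF

end GibbsMoments

/-- Powers up to four are dominated by `(1 + r²)²`. [folklore] -/
theorem pow_le_one_add_sq_sq {r : ℝ} (hr : 0 ≤ r) :
    r ≤ (1 + r ^ 2) ^ 2 ∧ r ^ 2 ≤ (1 + r ^ 2) ^ 2 ∧ r ^ 3 ≤ (1 + r ^ 2) ^ 2 ∧ r ^ 4 ≤ (1 + r ^ 2) ^ 2 := by
  refine ⟨?_, ?_, ?_, ?_⟩ <;> nlinarith [sq_nonneg (r - 1), sq_nonneg r, sq_nonneg (r ^ 2 - r), pow_nonneg hr 3, pow_nonneg hr 4]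


section GaussianMomenta

variable {ω₂ lam β γ : ℝ} (hω : 0 < ω₂) (hl : 0 ≤ lam) (hβ : 0 ≤ β) {n : ℕ} {T : ℝ} (hT : 0 < T)
include hω hl hβ hT

/-- **Equipartition** `∫ p_i² dμ_T = T` (Stein with `F = p_i`), for every chain of the family.
[folklore] -/
theorem gibbs_sq_momentum (i : Fin n) :
    ∫ x, x.2 i ^ 2 ∂((pinnedChain ω₂ lam β γ).gibbsMeasure n T) = T := by
  haveI : IsProbabilityMeasure ((pinnedChain ω₂ lam β γ).gibbsMeasure n T) :=
    pinnedChain_isProbabilityMeasure_gibbsMeasure hω hl hβ γ n hT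
  have hpc : Continuous fun x : PhaseSpace n => x.2 i := by fun_prop
  have hline : ∀ x : PhaseSpace n, HasLineDerivAt ℝ (fun x : PhaseSpace n => x.2 i) 1 x
      ((0, Pi.single i 1) : PhaseSpace n) := by
    intro x
    unfold HasLineDerivAt
    have key : (fun s : ℝ => (fun x : PhaseSpace n => x.2 i) (x + s • ((0, Pi.single i 1) : PhaseSpace n))) =
        fun s => x.2 i + s := by
      funext s
      simp
    rw [key]
    exact (hasDerivAt_id (0 : ℝ)).const_add _
  have hA1 : ∀ x : PhaseSpace n, |x.2 i| ≤ 1 * (1 + ‖x‖ ^ 2) ^ 2 := fun x => by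
    have h1 := OscillatorChain.abs_snd_apply_le_norm x i
    have h2 := (pow_le_one_add_sq_sq (norm_nonneg x)).1
    linarith
  have hA2 : ∀ x : PhaseSpace n, |(1 : ℝ)| ≤ 1 * (1 + ‖x‖ ^ 2) ^ 2 := fun x => by
    rw [abs_one]; nlinarith [norm_nonneg x]
  have hA3 : ∀ x : PhaseSpace n, |x.2 i * x.2 i| ≤ 1 * (1 + ‖x‖ ^ 2) ^ 2 := fun x => by
    have h1 := OscillatorChain.abs_snd_apply_le_norm x i
    have h2 := (pow_le_one_add_sq_sq (norm_nonneg x)).2.1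
    rw [abs_mul]
    calc |x.2 i| * |x.2 i| ≤ ‖x‖ * ‖x‖ := mul_le_mul h1 h1 (abs_nonneg _) (norm_nonneg _)
      _ ≤ 1 * (1 + ‖x‖ ^ 2) ^ 2 := by nlinarith
  have h := stein_momentum (γ := γ) hω hl hβ hT i (F := fun x => x.2 i) (F' := fun _ => (1 : ℝ))
    hpc continuous_const hline (A := 1) hA1 hA2 hA3
  rw [integral_const, probReal_univ, one_smul, mul_one] at h
  calc ∫ x, x.2 i ^ 2 ∂((pinnedChain ω₂ lam β γ).gibbsMeasure n T)
      = ∫ x, x.2 i * x.2 i ∂((pinnedChain ω₂ lam β γ).gibbsMeasure n T) :=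
        integral_congr_ae (Eventually.of_forall fun x => pow_two (x.2 i))
    _ = T := h

/-- **Stein with a linear observable**: `∫ p_i L dμ_T = T · L(e_{p_i})` for a continuous linear
functional `L`. [folklore] -/
theorem gibbs_momentum_mul_clm (i : Fin n) (L : PhaseSpace n →L[ℝ] ℝ) :
    ∫ x, x.2 i * L x ∂((pinnedChain ω₂ lam β γ).gibbsMeasure n T) =
      T * L ((0, Pi.single i 1) : PhaseSpace n) := by
  haveI : IsProbabilityMeasure ((pinnedChain ω₂ lam β γ).gibbsMeasure n T) :=
    pinnedChain_isProbabilityMeasure_gibbsMeasure hω hl hβ γ n hT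
  set G := ‖L‖ with hG
  set g₀ := L ((0, Pi.single i 1) : PhaseSpace n) with hg₀
  have hgb : ∀ x, |L x| ≤ G * ‖x‖ := fun x => by
    have := L.le_opNorm x; rwa [Real.norm_eq_abs] at this
  have hline : ∀ x, HasLineDerivAt ℝ (fun x => L x) g₀ x ((0, Pi.single i 1) : PhaseSpace n) := fun x =>
    (L.hasFDerivAt).hasLineDerivAt _
  have hpc : Continuous fun x : PhaseSpace n => x.2 i := by fun_prop
  have hA1 : ∀ x : PhaseSpace n, |L x| ≤ max G |g₀| * (1 + ‖x‖ ^ 2) ^ 2 := fun x => by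
    have h2 := (pow_le_one_add_sq_sq (norm_nonneg x)).1
    calc |L x| ≤ G * ‖x‖ := hgb x
      _ ≤ max G |g₀| * (1 + ‖x‖ ^ 2) ^ 2 :=
          mul_le_mul (le_max_left _ _) h2 (norm_nonneg _) (le_trans (norm_nonneg L) (le_max_left _ _))
  have hA2 : ∀ x : PhaseSpace n, |g₀| ≤ max G |g₀| * (1 + ‖x‖ ^ 2) ^ 2 := fun x => by
    have h1 : (1 : ℝ) ≤ (1 + ‖x‖ ^ 2) ^ 2 := by nlinarith [norm_nonneg x]
    calc |g₀| = |g₀| * 1 := by ring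
      _ ≤ max G |g₀| * (1 + ‖x‖ ^ 2) ^ 2 :=
          mul_le_mul (le_max_right _ _) h1 zero_le_one (le_trans (abs_nonneg _) (le_max_right _ _))
  have hA3 : ∀ x : PhaseSpace n, |x.2 i * L x| ≤ max G |g₀| * (1 + ‖x‖ ^ 2) ^ 2 := fun x => by
    have h1 := OscillatorChain.abs_snd_apply_le_norm x i
    have h4 := (pow_le_one_add_sq_sq (norm_nonneg x)).2.1
    rw [abs_mul]
    calc |x.2 i| * |L x| ≤ ‖x‖ * (G * ‖x‖) := mul_le_mul h1 (hgb x) (abs_nonneg _) (norm_nonneg _)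
      _ = G * ‖x‖ ^ 2 := by ring
      _ ≤ max G |g₀| * (1 + ‖x‖ ^ 2) ^ 2 :=
          mul_le_mul (le_max_left _ _) h4 (by positivity) (le_trans (norm_nonneg L) (le_max_left _ _))
  have h := stein_momentum (γ := γ) hω hl hβ hT i (F := fun x => L x) (F' := fun _ => g₀)
    L.continuous continuous_const hline hA1 hA2 hA3
  rw [integral_const, probReal_univ, one_smul] at h
  exact h

/-- **The Gaussian (Wick) pair identity of the Gibbs measure**: for a continuous linear functional
`L`, `∫ p_i² L² dμ_T = T ∫ L² dμ_T + 2 (∫ p_i L dμ_T)²` (Stein with `F = p_i L²`), for every chain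
of the family — momenta are exactly Gaussian and independent of positions. [folklore] -/
theorem gibbs_sq_momentum_mul_clm_sq (i : Fin n) (L : PhaseSpace n →L[ℝ] ℝ) :
    ∫ x, x.2 i ^ 2 * L x ^ 2 ∂((pinnedChain ω₂ lam β γ).gibbsMeasure n T) =
      T * ∫ x, L x ^ 2 ∂((pinnedChain ω₂ lam β γ).gibbsMeasure n T) +
        2 * (∫ x, x.2 i * L x ∂((pinnedChain ω₂ lam β γ).gibbsMeasure n T)) ^ 2 := by
  set μ := (pinnedChain ω₂ lam β γ).gibbsMeasure n T with hμ
  set G := ‖L‖ with hG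
  set v₀ : PhaseSpace n := (0, Pi.single i 1) with hv₀
  set g₀ := L v₀ with hg₀
  have hgb : ∀ x, |L x| ≤ G * ‖x‖ := fun x => by
    have := L.le_opNorm x; rwa [Real.norm_eq_abs] at this
  have hpc : Continuous fun x : PhaseSpace n => x.2 i := by fun_prop
  have hLc : Continuous fun x : PhaseSpace n => L x := L.continuous
  -- the line derivative of `p_i L²`
  have hline : ∀ x : PhaseSpace n, HasLineDerivAt ℝ (fun x : PhaseSpace n => x.2 i * L x ^ 2)
      (L x ^ 2 + 2 * x.2 i * L x * g₀) x v₀ := by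
    intro x
    unfold HasLineDerivAt
    have key : (fun s : ℝ => (fun x : PhaseSpace n => x.2 i * L x ^ 2) (x + s • v₀)) =
        fun s => (x.2 i + s) * (L x + s * g₀) ^ 2 := by
      funext s
      simp only [map_add, map_smul, smul_eq_mul, hv₀, Prod.snd_add, Prod.smul_snd, Pi.add_apply,
        Pi.smul_apply, Pi.single_eq_same, mul_one]
      ring
    rw [key]
    have h1 : HasDerivAt (fun s : ℝ => x.2 i + s) 1 0 := (hasDerivAt_id (0 : ℝ)).const_add _
    have h2 : HasDerivAt (fun s : ℝ => L x + s * g₀) (1 * g₀) 0 := ((hasDerivAt_id (0 : ℝ)).mul_const g₀).const_add _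
    have h4 := h1.mul (h2.pow 2)
    refine h4.congr_deriv ?_
    norm_num
    ring
  -- growth bounds
  set A : ℝ := G ^ 2 + 2 * |g₀| * G with hA
  have hG0 : 0 ≤ G := norm_nonneg _
  have hA1 : ∀ x : PhaseSpace n, |x.2 i * L x ^ 2| ≤ A * (1 + ‖x‖ ^ 2) ^ 2 := fun x => by
    have h1 := OscillatorChain.abs_snd_apply_le_norm x i
    have h5 := (pow_le_one_add_sq_sq (norm_nonneg x)).2.2.1
    rw [abs_mul, abs_pow]
    have e2 : |L x| ^ 2 ≤ (G * ‖x‖) ^ 2 := pow_le_pow_left₀ (abs_nonneg _) (hgb x) 2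
    have hpos : 0 ≤ 2 * |g₀| * G * (1 + ‖x‖ ^ 2) ^ 2 := by positivity
    calc |x.2 i| * |L x| ^ 2 ≤ ‖x‖ * (G * ‖x‖) ^ 2 := mul_le_mul h1 e2 (by positivity) (norm_nonneg _)
      _ = G ^ 2 * ‖x‖ ^ 3 := by ring
      _ ≤ G ^ 2 * (1 + ‖x‖ ^ 2) ^ 2 := by nlinarith [sq_nonneg G]
      _ ≤ A * (1 + ‖x‖ ^ 2) ^ 2 := by rw [hA]; nlinarith
  have hA2 : ∀ x : PhaseSpace n, |L x ^ 2 + 2 * x.2 i * L x * g₀| ≤ A * (1 + ‖x‖ ^ 2) ^ 2 := fun x => by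
    have h1 := OscillatorChain.abs_snd_apply_le_norm x i
    have h4 := (pow_le_one_add_sq_sq (norm_nonneg x)).2.1
    have e1 : |L x ^ 2| ≤ G ^ 2 * (1 + ‖x‖ ^ 2) ^ 2 := by
      rw [abs_pow]
      calc |L x| ^ 2 ≤ (G * ‖x‖) ^ 2 := pow_le_pow_left₀ (abs_nonneg _) (hgb x) 2
        _ = G ^ 2 * ‖x‖ ^ 2 := by ring
        _ ≤ G ^ 2 * (1 + ‖x‖ ^ 2) ^ 2 := by nlinarith [sq_nonneg G]
    have e2 : |x.2 i * L x| ≤ G * (1 + ‖x‖ ^ 2) ^ 2 := by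
      rw [abs_mul]
      calc |x.2 i| * |L x| ≤ ‖x‖ * (G * ‖x‖) := mul_le_mul h1 (hgb x) (abs_nonneg _) (norm_nonneg _)
        _ = G * ‖x‖ ^ 2 := by ring
        _ ≤ G * (1 + ‖x‖ ^ 2) ^ 2 := by nlinarith
    calc |L x ^ 2 + 2 * x.2 i * L x * g₀| ≤ |L x ^ 2| + |2 * x.2 i * L x * g₀| := abs_add_le _ _
      _ = |L x ^ 2| + 2 * |g₀| * |x.2 i * L x| := by
          rw [show 2 * x.2 i * L x * g₀ = (2 * g₀) * (x.2 i * L x) by ring, abs_mul, abs_mul, abs_two]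
      _ ≤ G ^ 2 * (1 + ‖x‖ ^ 2) ^ 2 + 2 * |g₀| * (G * (1 + ‖x‖ ^ 2) ^ 2) := by gcongr
      _ = A * (1 + ‖x‖ ^ 2) ^ 2 := by rw [hA]; ring
  have hA3 : ∀ x : PhaseSpace n, |x.2 i * (x.2 i * L x ^ 2)| ≤ A * (1 + ‖x‖ ^ 2) ^ 2 := fun x => by
    have h1 := OscillatorChain.abs_snd_apply_le_norm x i
    have h6 := (pow_le_one_add_sq_sq (norm_nonneg x)).2.2.2
    rw [show x.2 i * (x.2 i * L x ^ 2) = x.2 i ^ 2 * L x ^ 2 by ring, abs_mul, abs_pow, abs_pow]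
    have e1 : |x.2 i| ^ 2 ≤ ‖x‖ ^ 2 := pow_le_pow_left₀ (abs_nonneg _) h1 2
    have e2 : |L x| ^ 2 ≤ (G * ‖x‖) ^ 2 := pow_le_pow_left₀ (abs_nonneg _) (hgb x) 2
    have hpos : 0 ≤ 2 * |g₀| * G * (1 + ‖x‖ ^ 2) ^ 2 := by positivity
    calc |x.2 i| ^ 2 * |L x| ^ 2 ≤ ‖x‖ ^ 2 * (G * ‖x‖) ^ 2 := mul_le_mul e1 e2 (by positivity) (by positivity)
      _ = G ^ 2 * ‖x‖ ^ 4 := by ring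
      _ ≤ G ^ 2 * (1 + ‖x‖ ^ 2) ^ 2 := by nlinarith [sq_nonneg G]
      _ ≤ A * (1 + ‖x‖ ^ 2) ^ 2 := by rw [hA]; nlinarith
  have hS3 := stein_momentum (γ := γ) hω hl hβ hT i (F := fun x => x.2 i * L x ^ 2)
    (F' := fun x => L x ^ 2 + 2 * x.2 i * L x * g₀) (hpc.mul (hLc.pow 2)) (by fun_prop) hline hA1 hA2 hA3
  -- integrability of `L²` and `p_i L`
  have hI_gg : Integrable (fun x : PhaseSpace n => L x ^ 2) μ := by
    refine integrable_gibbsMeasure_of_growth hω hl hβ hT (hLc.pow 2) (A := G ^ 2) fun x => ?_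
    rw [abs_pow]
    have h4 := (pow_le_one_add_sq_sq (norm_nonneg x)).2.1
    calc |L x| ^ 2 ≤ (G * ‖x‖) ^ 2 := pow_le_pow_left₀ (abs_nonneg _) (hgb x) 2
      _ = G ^ 2 * ‖x‖ ^ 2 := by ring
      _ ≤ G ^ 2 * (1 + ‖x‖ ^ 2) ^ 2 := by nlinarith [sq_nonneg G]
  have hI_pg : Integrable (fun x : PhaseSpace n => x.2 i * L x) μ := by
    refine integrable_gibbsMeasure_of_growth hω hl hβ hT (hpc.mul hLc) (A := G) fun x => ?_
    have h1 := OscillatorChain.abs_snd_apply_le_norm x i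
    have h4 := (pow_le_one_add_sq_sq (norm_nonneg x)).2.1
    rw [abs_mul]
    calc |x.2 i| * |L x| ≤ ‖x‖ * (G * ‖x‖) := mul_le_mul h1 (hgb x) (abs_nonneg _) (norm_nonneg _)
      _ = G * ‖x‖ ^ 2 := by ring
      _ ≤ G * (1 + ‖x‖ ^ 2) ^ 2 := by nlinarith
  have hS1 : ∫ x, x.2 i * L x ∂μ = T * g₀ := gibbs_momentum_mul_clm hω hl hβ hT i L
  have e1 : ∫ x, x.2 i ^ 2 * L x ^ 2 ∂μ = ∫ x, x.2 i * (x.2 i * L x ^ 2) ∂μ :=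
    integral_congr_ae (Eventually.of_forall fun x => by simp only; ring)
  have hI1 : Integrable (fun x : PhaseSpace n => 2 * g₀ * (x.2 i * L x)) μ := hI_pg.const_mul _
  have e2 : ∫ x, (L x ^ 2 + 2 * x.2 i * L x * g₀) ∂μ = (∫ x, L x ^ 2 ∂μ) + 2 * g₀ * ∫ x, x.2 i * L x ∂μ := by
    have : (fun x : PhaseSpace n => L x ^ 2 + 2 * x.2 i * L x * g₀) =
        fun x => L x ^ 2 + 2 * g₀ * (x.2 i * L x) := funext fun x => by ring
    rw [this, integral_add hI_gg hI1, integral_const_mul]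
  rw [e1, hS3, e2, hS1]
  ring

end GaussianMomenta

end Summit.AtomisticToContinuum.FouriersLaw.Theorems.IncoherentChannel.Negative.GibbsStein
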